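import Mathlib
import Summits.Ventures.HodgeRepro.Tier4.Line4.CentreCocompactAniso
import Summits.Ventures.HodgeRepro.Tier4.Line4.CharacterExtendPair
import Summits.Ventures.HodgeRepro.Tier4.Line4.WeightCharacterSeesawPrime

/-!
# Tier4/Line4/CharacterPairSeesaw — the wall's PAIR `(chi, chi′)` with `chi_centre` (N2) on the SEESAW PLANE, modulo
the print and ONE displayed consistency clause (C-L4-B-EXTEND, part 5 = the torus half of (r5))

Blind re-derivation cell `pub-hodge-repro`, Tier 4 «prove the step» (README §9–§10), seat t4-x2 (reserve
wall-breaker, gen 6; GO S16576).  Tree path `lean/Summits/Ventures/HodgeRepro/Tier4/Line4/CharacterPairSeesaw.lean`.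
Imports: Mathlib + Line4 (`CentreCocompactAniso` (L4-p2, p720362; through it `CentreCocompact` (typer-2):
`isClosed_centre`); `CharacterExtendPair`: the generic joint extension; `WeightCharacterSeesawPrime` /
`WeightCharacterSeesaw` / `WeightCharacter` / `CharacterExtend`: the `T′` weight character, the twins of p723452, the
row-plane facts on the seesaw plane).  No definition, no instance, no printed theorem proved.

WHAT.  Given ANY continuous unitary character `chi` of `T(𝔸)` (e.g. part 3a's, with `_hchi`), a character `chi′` of
`T′(𝔸)` is built that is multiplicative, trivial on `T′(k)`, continuous, unitary, has the prescribed `K`-types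
(`_hchi'`) AND AGREES WITH `chi` ON THE CENTRE `Z(𝔸)` (`chi_centre`, N2) — by the joint extension of the `T′_∞` weight
character and of `chi|_Z` from the closed subgroup `Z(𝔸) · T′_∞` of `T′(𝔸)` (modulo `T′(k)`), modulo
* the print [DE14] Cor. 3.6.2 on the compact `T′(k)\T′(𝔸)` (`hDE'`), and
* ONE displayed clause `hcons`: for `t ∈ T′_∞` and central `z` with `t · z ∈ T′(k)`,
  `torusWeight' eP′ eM′ t · chi z = 1` — the consistency of the two characters on the rational points of
  `Z(𝔸) · T′_∞` (paper reading, NOT typed: such a `t · z` is a rational element whose finite part is central, hence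
  lies in `T(k)`; so `t ∈ T_∞ ∩ T′_∞` and the clause is the agreement of the two weight characters on `T_∞ ∩ T′_∞`,
  i.e. on `Z_∞` in general position: `eP w + eM w = eP′ w + eM′ w` — the dictionary's relation).
Ingredients by name: `Z(𝔸)` is closed in `T′(𝔸)` (`isClosed_centre_subgroupOf_torusT'`, from typer-2's
`isClosed_centre`); `T′_∞` compact (TorusInfCompactConj); `T′(𝔸)` commutative, `T′(k)` closed and cocompact
(WeightCharacterSeesawPrime / WeightCharacterSeesaw / TorusCocompactAniso).  DISPLAYED BINDER `hZ`: `Z(𝔸)` is cocompact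
modulo `T′(k)` inside `T′(𝔸)` (`Z ⊆ T′(k) · D`, `D ⊆ Z` compact) — L4-p2's `centre_cocompact_of_anisotropic`
(p720362, stated inside `T(𝔸)`) read in `T′(𝔸)` through `Z ≤ T ⊓ T′`; the transport was attempted here
(`exists_compact_centre_cover_torusT'`) and WITHDRAWN: the kernel times out on the membership transport between
`(centre W).subgroupOf (torusT W)` and `(centre W).subgroupOf (torusT' W)` (a `Membership` rewrite lemma would fix it;
census).
* `isClosed_centre_subgroupOf_torusT'`, `exists_centre_character_of_chi` (any plane), `chiMatchesAt'_seesaw_of_eq_torusWeight'`;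
* **`exists_wall_character'_pair_seesaw`** — the theorem above.
Nothing here says anything about the status of the Hodge conjecture for CM abelian varieties, which is NOT proved;
HC_CM is NOT proved by anyone in this repository.
-/

set_option autoImplicit false

noncomputable section

namespace Summit.Ventures.HodgeRepro.Tier4.Line4

open NumberField Matrix Summit.Ventures.HodgeRepro.Tier4.Common Summit.Ventures.HodgeRepro.Tier4.Line1
  Summit.Ventures.HodgeRepro.Tier4.Lit
open scoped Pointwise

section Pair

variable {k : Type} [Field k] [NumberField k] (q : QuadData k) (a : Fin 4 → k)
  (g g' : Matrix (Fin 4) (Fin 4) k) (hgg' : g * g' = 1) (hg'g : g' * g = 1)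
  (hgΩ : g * (PlaneData.mixedRow q (a 0) (a 2)).Ω = (PlaneData.mixedRow q (a 0) (a 2)).Ω * g)
  (lam : k) (hlam : lam ≠ 0)
  (hiso : g * (PlaneData.mixedRow q (a 1) (a 3)).B * gᵀ = lam • (PlaneData.mixedRow q (a 0) (a 2)).B)

/-- `Z(𝔸)` is closed in `T′(𝔸)` (any plane; the `T′` twin of typer-2's `isClosed_centre_subgroupOf_torusT`). -/
theorem isClosed_centre_subgroupOf_torusT' (W : PlaneData k) :
    IsClosed (((centre W).subgroupOf (torusT' W) : Subgroup (torusT' W)) : Set (torusT' W)) := by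
  rw [Subgroup.coe_subgroupOf]
  exact (isClosed_centre W).preimage continuous_subtype_val

/-- **A continuous unitary character of `T(𝔸)` restricted to the centre, as a character of `Z(𝔸) ≤ T′(𝔸)`** (any
plane; `Z ≤ T ⊓ T′`). -/
theorem exists_centre_character_of_chi (W : PlaneData k) (chi : torusT W → ℂ)
    (hmul : ∀ s t, chi (s * t) = chi s * chi t) (hcont : Continuous chi) (hunit : ∀ t, ‖chi t‖ = 1) :
    ∃ ω : ContinuousMonoidHom ((centre W).subgroupOf (torusT' W)) Circle,
      ∀ z : (centre W).subgroupOf (torusT' W),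
        ((ω z : Circle) : ℂ) = chi ⟨(z.1 : GA W), centre_le_torusT W (Subgroup.mem_subgroupOf.1 z.2)⟩ := by
  let toT : (centre W).subgroupOf (torusT' W) → torusT W := fun z =>
    ⟨(z.1 : GA W), centre_le_torusT W (Subgroup.mem_subgroupOf.1 z.2)⟩
  have htoT_cont : Continuous toT := Continuous.subtype_mk (continuous_subtype_val.comp continuous_subtype_val) _
  have htoT_mul : ∀ z z', toT (z * z') = toT z * toT z' := fun z z' => rfl
  have htoT_one : toT 1 = 1 := rfl
  have hmem : ∀ z, chi (toT z) ∈ Submonoid.unitSphere ℂ := fun z => mem_sphere_zero_iff_norm.mpr (hunit _)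
  have h1 : chi 1 = 1 := by
    have h := hmul 1 1
    rw [one_mul] at h
    have h0 : chi 1 ≠ 0 := by
      intro h0
      have := hunit 1
      rw [h0, norm_zero] at this
      exact zero_ne_one this
    exact (mul_left_eq_self₀.1 h.symm).resolve_right h0
  refine ⟨{ toFun := fun z => ⟨chi (toT z), hmem z⟩
            map_one' := Subtype.ext (by show chi (toT 1) = 1; rw [htoT_one]; exact h1)
            map_mul' := fun z z' => Subtype.ext (by
              show chi (toT (z * z')) = chi (toT z) * chi (toT z')
              rw [htoT_mul z z']
              exact hmul (toT z) (toT z'))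
            continuous_toFun := Continuous.subtype_mk (hcont.comp htoT_cont) _ }, fun z => rfl⟩

include lam hlam hiso in
/-- **`_hchi'` from the values on `T′_∞`**: a function on `T′(𝔸)` equal to `torusWeight' eP′ eM′` on `T′_∞` matches
the `K`-type `(eP′ w, eM′ w)` at every infinite place (the proof of WeightCharacterSeesawPrime's `_hchi'` clause). -/
theorem chiMatchesAt'_seesaw_of_eq_torusWeight' (ha1 : a 1 ≠ 0) (ha3 : a 3 ≠ 0)
    (hreal : ∀ w : InfinitePlace k, w.IsReal) (hcm : ∀ w, IsCMAt q w) (eP' eM' : InfinitePlace k → ℤ)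
    (chi' : torusT' ((PlaneData.mixedRow q (a 0) (a 2)).withTransportedTorus g g' hgg' hg'g hgΩ) → ℂ)
    (h : ∀ κ : torusT' ((PlaneData.mixedRow q (a 0) (a 2)).withTransportedTorus g g' hgg' hg'g hgΩ),
      κ ∈ torusInf' ((PlaneData.mixedRow q (a 0) (a 2)).withTransportedTorus g g' hgg' hg'g hgΩ) →
      chi' κ = torusWeight' q a g g' hgg' hg'g hgΩ eP' eM' κ.1) (w : InfinitePlace k) :
    ChiMatchesAt' ((PlaneData.mixedRow q (a 0) (a 2)).withTransportedTorus g g' hgg' hg'g hgΩ) q w g g' (eP' w) (eM' w)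
      chi' := by
  intro κ hκ
  have hκinf : κ ∈ torusInf' ((PlaneData.mixedRow q (a 0) (a 2)).withTransportedTorus g g' hgg' hg'g hgΩ) := by
    rw [torusInf', Subgroup.mem_subgroupOf]
    exact mem_infinitePart_of_mem_atPlace _ hκ.2
  rw [h κ hκinf, torusWeight'_of_mem_localTorusAt' q a g g' hgg' hg'g hgΩ lam hlam hiso eP' eM' hκ]
  have hA0 : weightAt' ((PlaneData.mixedRow q (a 0) (a 2)).withTransportedTorus g g' hgg' hg'g hgΩ) q w g g' 0
      κ.1 ^ (eP' w) ≠ 0 :=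
    zpow_ne_zero _ (weightAt'_ne_zero_of_mem_torusT' q a g g' hgg' hg'g hgΩ lam hlam hiso w (hreal w) (hcm w)
      ha1 ha3 0 κ.2)
  have hB0 : weightAt' ((PlaneData.mixedRow q (a 0) (a 2)).withTransportedTorus g g' hgg' hg'g hgΩ) q w g g' 1
      κ.1 ^ (eM' w) ≠ 0 :=
    zpow_ne_zero _ (weightAt'_ne_zero_of_mem_torusT' q a g g' hgg' hg'g hgΩ lam hlam hiso w (hreal w) (hcm w)
      ha1 ha3 1 κ.2)
  rw [_root_.zpow_neg, _root_.zpow_neg]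
  field_simp

/-! ### The pair on the seesaw plane -/

include lam hlam hiso in
/-- **THE WALL'S `chi′` WITH `_hchi'` AND `chi_centre` (N2) ON THE SEESAW PLANE, modulo the print and `hcons`**: for
any continuous unitary character `chi` of `T(𝔸)` and any integers `eP′ eM′`, a `chi′ : T′(𝔸) → ℂ` multiplicative,
trivial on `T′(k)`, continuous, of modulus one, with `ChiMatchesAt' … g g' (eP′ w) (eM′ w) chi′` at every infinite
place and `chi′ = chi` on the centre `Z(𝔸)`.  `hDE'` = the print [DE14] Cor. 3.6.2 on the compact `T′(k)\T′(𝔸)`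
(binder shape of `exists_wall_character'_ktypes_seesaw`); `hcons` = the consistency of `torusWeight' eP′ eM′` and
`chi` on the rational points of `Z(𝔸) · T′_∞` (see the module docstring). -/
theorem exists_wall_character'_pair_seesaw (ht : q.t = 0) (hn : ¬ IsSquare (-q.n)) (ha : ∀ i, a i ≠ 0)
    (hreal : ∀ w : InfinitePlace k, w.IsReal) (hcm : ∀ w, IsCMAt q w)
    (hA : IsAnisotropic ((PlaneData.mixedRow q (a 0) (a 2)).withTransportedTorus g g' hgg' hg'g hgΩ))
    (hZ : ∃ D : Set (torusT' ((PlaneData.mixedRow q (a 0) (a 2)).withTransportedTorus g g' hgg' hg'g hgΩ)),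
      IsCompact D ∧
      D ⊆ (((centre ((PlaneData.mixedRow q (a 0) (a 2)).withTransportedTorus g g' hgg' hg'g hgΩ)).subgroupOf
        (torusT' ((PlaneData.mixedRow q (a 0) (a 2)).withTransportedTorus g g' hgg' hg'g hgΩ)) :
        Subgroup (torusT' ((PlaneData.mixedRow q (a 0) (a 2)).withTransportedTorus g g' hgg' hg'g hgΩ))) :
        Set (torusT' ((PlaneData.mixedRow q (a 0) (a 2)).withTransportedTorus g g' hgg' hg'g hgΩ))) ∧
      ∀ z ∈ (centre ((PlaneData.mixedRow q (a 0) (a 2)).withTransportedTorus g g' hgg' hg'g hgΩ)).subgroupOf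
        (torusT' ((PlaneData.mixedRow q (a 0) (a 2)).withTransportedTorus g g' hgg' hg'g hgΩ)),
        ∃ γ ∈ rationalOf ((PlaneData.mixedRow q (a 0) (a 2)).withTransportedTorus g g' hgg' hg'g hgΩ)
          (torusT' ((PlaneData.mixedRow q (a 0) (a 2)).withTransportedTorus g g' hgg' hg'g hgΩ)), ∃ d ∈ D, z = γ * d)
    (chi : torusT ((PlaneData.mixedRow q (a 0) (a 2)).withTransportedTorus g g' hgg' hg'g hgΩ) → ℂ)
    (hmul : ∀ s t, chi (s * t) = chi s * chi t) (hcont : Continuous chi) (hunit : ∀ t, ‖chi t‖ = 1)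
    (hDE' : letI : CommGroup (torusT' ((PlaneData.mixedRow q (a 0) (a 2)).withTransportedTorus g g' hgg' hg'g hgΩ)) :=
        { (inferInstance : Group (torusT' ((PlaneData.mixedRow q (a 0) (a 2)).withTransportedTorus g g' hgg' hg'g hgΩ)))
          with mul_comm := torusT'_seesaw_mul_comm q a g g' hgg' hg'g hgΩ lam hlam hiso (ha 1) (ha 3) }
      haveI : IsClosed ((rationalOf ((PlaneData.mixedRow q (a 0) (a 2)).withTransportedTorus g g' hgg' hg'g hgΩ)
          (torusT' ((PlaneData.mixedRow q (a 0) (a 2)).withTransportedTorus g g' hgg' hg'g hgΩ)) :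
          Subgroup (torusT' ((PlaneData.mixedRow q (a 0) (a 2)).withTransportedTorus g g' hgg' hg'g hgΩ))) :
          Set (torusT' ((PlaneData.mixedRow q (a 0) (a 2)).withTransportedTorus g g' hgg' hg'g hgΩ))) :=
        isClosed_rationalOf_torusT' _
      haveI : CompactSpace (torusT' ((PlaneData.mixedRow q (a 0) (a 2)).withTransportedTorus g g' hgg' hg'g hgΩ) ⧸
          rationalOf ((PlaneData.mixedRow q (a 0) (a 2)).withTransportedTorus g g' hgg' hg'g hgΩ)
            (torusT' ((PlaneData.mixedRow q (a 0) (a 2)).withTransportedTorus g g' hgg' hg'g hgΩ))) :=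
        compactSpace_quotient_of_cocompact _ (cocompact_rationalOf_torusT'_of_anisotropic _
          (isGenuineRow_seesawPlane q ht hn a (ha 0) (ha 2) g g' hgg' hg'g hgΩ lam hlam hiso) hA)
      DeitmarEchterhoff2014_Cor_3_6_2_restriction_surjective
        (torusT' ((PlaneData.mixedRow q (a 0) (a 2)).withTransportedTorus g g' hgg' hg'g hgΩ) ⧸
          rationalOf ((PlaneData.mixedRow q (a 0) (a 2)).withTransportedTorus g g' hgg' hg'g hgΩ)
            (torusT' ((PlaneData.mixedRow q (a 0) (a 2)).withTransportedTorus g g' hgg' hg'g hgΩ))))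
    (eP' eM' : InfinitePlace k → ℤ)
    (hcons : ∀ (t : torusT' ((PlaneData.mixedRow q (a 0) (a 2)).withTransportedTorus g g' hgg' hg'g hgΩ))
      (z : GA ((PlaneData.mixedRow q (a 0) (a 2)).withTransportedTorus g g' hgg' hg'g hgΩ))
      (hz : z ∈ centre ((PlaneData.mixedRow q (a 0) (a 2)).withTransportedTorus g g' hgg' hg'g hgΩ)),
      (t : GA _) ∈ infinitePart ((PlaneData.mixedRow q (a 0) (a 2)).withTransportedTorus g g' hgg' hg'g hgΩ) →
      (t : GA _) * z ∈ rationalPoints ((PlaneData.mixedRow q (a 0) (a 2)).withTransportedTorus g g' hgg' hg'g hgΩ) →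
      torusWeight' q a g g' hgg' hg'g hgΩ eP' eM' (t : GA _) * chi ⟨z, centre_le_torusT _ hz⟩ = 1) :
    ∃ chi' : torusT' ((PlaneData.mixedRow q (a 0) (a 2)).withTransportedTorus g g' hgg' hg'g hgΩ) → ℂ,
      (∀ s t, chi' (s * t) = chi' s * chi' t) ∧
      (∀ t ∈ rationalOf ((PlaneData.mixedRow q (a 0) (a 2)).withTransportedTorus g g' hgg' hg'g hgΩ)
        (torusT' ((PlaneData.mixedRow q (a 0) (a 2)).withTransportedTorus g g' hgg' hg'g hgΩ)), chi' t = 1) ∧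
      Continuous chi' ∧ (∀ t, ‖chi' t‖ = 1) ∧
      (∀ w : InfinitePlace k, ChiMatchesAt' ((PlaneData.mixedRow q (a 0) (a 2)).withTransportedTorus g g' hgg' hg'g hgΩ)
        q w g g' (eP' w) (eM' w) chi') ∧
      ∀ (z : GA ((PlaneData.mixedRow q (a 0) (a 2)).withTransportedTorus g g' hgg' hg'g hgΩ))
        (hz : z ∈ centre ((PlaneData.mixedRow q (a 0) (a 2)).withTransportedTorus g g' hgg' hg'g hgΩ)),
        chi ⟨z, centre_le_torusT _ hz⟩ = chi' ⟨z, centre_le_torusT' _ hz⟩ := by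
  letI : CommGroup (torusT' ((PlaneData.mixedRow q (a 0) (a 2)).withTransportedTorus g g' hgg' hg'g hgΩ)) :=
    { (inferInstance : Group (torusT' ((PlaneData.mixedRow q (a 0) (a 2)).withTransportedTorus g g' hgg' hg'g hgΩ)))
      with mul_comm := torusT'_seesaw_mul_comm q a g g' hgg' hg'g hgΩ lam hlam hiso (ha 1) (ha 3) }
  haveI : IsClosed ((rationalOf ((PlaneData.mixedRow q (a 0) (a 2)).withTransportedTorus g g' hgg' hg'g hgΩ)
      (torusT' ((PlaneData.mixedRow q (a 0) (a 2)).withTransportedTorus g g' hgg' hg'g hgΩ)) :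
      Subgroup (torusT' ((PlaneData.mixedRow q (a 0) (a 2)).withTransportedTorus g g' hgg' hg'g hgΩ))) :
      Set (torusT' ((PlaneData.mixedRow q (a 0) (a 2)).withTransportedTorus g g' hgg' hg'g hgΩ))) :=
    isClosed_rationalOf_torusT' _
  have hgen : IsGenuineRow ((PlaneData.mixedRow q (a 0) (a 2)).withTransportedTorus g g' hgg' hg'g hgΩ) :=
    isGenuineRow_seesawPlane q ht hn a (ha 0) (ha 2) g g' hgg' hg'g hgΩ lam hlam hiso
  haveI : CompactSpace (torusT' ((PlaneData.mixedRow q (a 0) (a 2)).withTransportedTorus g g' hgg' hg'g hgΩ) ⧸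
      rationalOf ((PlaneData.mixedRow q (a 0) (a 2)).withTransportedTorus g g' hgg' hg'g hgΩ)
        (torusT' ((PlaneData.mixedRow q (a 0) (a 2)).withTransportedTorus g g' hgg' hg'g hgΩ))) :=
    compactSpace_quotient_of_cocompact _ (cocompact_rationalOf_torusT'_of_anisotropic _ hgen hA)
  haveI : CompactSpace (torusInf' ((PlaneData.mixedRow q (a 0) (a 2)).withTransportedTorus g g' hgg' hg'g hgΩ)) :=
    compactSpace_infinitePart_subgroupOf_torusT'_seesaw q a g g' hgg' hg'g hgΩ lam hlam hiso (ha 1) (ha 3) hreal hcm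
  -- the `T′_∞` weight character and `chi` on the centre
  obtain ⟨ψ, hψ⟩ :=
    exists_weight_character'_seesaw q a g g' hgg' hg'g hgΩ lam hlam hiso (ha 1) (ha 3) hreal hcm eP' eM'
  let ι : ContinuousMonoidHom (torusInf' ((PlaneData.mixedRow q (a 0) (a 2)).withTransportedTorus g g' hgg' hg'g hgΩ))
      (torusT' ((PlaneData.mixedRow q (a 0) (a 2)).withTransportedTorus g g' hgg' hg'g hgΩ)) :=
    { (torusInf' ((PlaneData.mixedRow q (a 0) (a 2)).withTransportedTorus g g' hgg' hg'g hgΩ)).subtype with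
      continuous_toFun := continuous_subtype_val }
  let ψ' : ContinuousMonoidHom (torusInf' ((PlaneData.mixedRow q (a 0) (a 2)).withTransportedTorus g g' hgg' hg'g hgΩ))
      Circle := ψ.comp ι
  -- `chi` on the centre, as a character of `Z(𝔸) ≤ T′(𝔸)`
  obtain ⟨ω, hω⟩ := exists_centre_character_of_chi _ chi hmul hcont hunit
  -- the consistency clause in the generic shape
  have hcons' : ∀ (t : torusInf' ((PlaneData.mixedRow q (a 0) (a 2)).withTransportedTorus g g' hgg' hg'g hgΩ))
      (z : (centre ((PlaneData.mixedRow q (a 0) (a 2)).withTransportedTorus g g' hgg' hg'g hgΩ)).subgroupOf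
        (torusT' ((PlaneData.mixedRow q (a 0) (a 2)).withTransportedTorus g g' hgg' hg'g hgΩ))),
      t.1 * z.1 ∈ rationalOf ((PlaneData.mixedRow q (a 0) (a 2)).withTransportedTorus g g' hgg' hg'g hgΩ)
        (torusT' ((PlaneData.mixedRow q (a 0) (a 2)).withTransportedTorus g g' hgg' hg'g hgΩ)) →
      ψ' t * ω z = 1 := by
    intro t z hrat
    apply Subtype.ext
    show ((ψ t.1 : Circle) : ℂ) * ((ω z : Circle) : ℂ) = 1
    rw [hψ, hω]
    exact hcons t.1 z.1.1 (Subgroup.mem_subgroupOf.1 z.2) (Subgroup.mem_subgroupOf.1 t.2)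
      (Subgroup.mem_subgroupOf.1 hrat)
  -- the joint extension
  obtain ⟨χ, hΓ, hK, hZ⟩ := exists_continuousMonoidHom_extend_pair_of_print
    (rationalOf ((PlaneData.mixedRow q (a 0) (a 2)).withTransportedTorus g g' hgg' hg'g hgΩ)
      (torusT' ((PlaneData.mixedRow q (a 0) (a 2)).withTransportedTorus g g' hgg' hg'g hgΩ)))
    (torusInf' ((PlaneData.mixedRow q (a 0) (a 2)).withTransportedTorus g g' hgg' hg'g hgΩ))
    ((centre ((PlaneData.mixedRow q (a 0) (a 2)).withTransportedTorus g g' hgg' hg'g hgΩ)).subgroupOf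
      (torusT' ((PlaneData.mixedRow q (a 0) (a 2)).withTransportedTorus g g' hgg' hg'g hgΩ)))
    (isCompact_iff_compactSpace.mpr ‹_›) (isClosed_centre_subgroupOf_torusT' _) hZ hDE' ψ' ω hcons'
  refine ⟨fun t => ((χ t : Circle) : ℂ), fun s t => ?_, fun t ht => ?_, ?_, fun t => Circle.norm_coe _, ?_,
    fun z hz => ?_⟩
  · show ((χ (s * t) : Circle) : ℂ) = ((χ s : Circle) : ℂ) * ((χ t : Circle) : ℂ)
    rw [map_mul, Circle.coe_mul]
  · show ((χ t : Circle) : ℂ) = 1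
    rw [hΓ t ht, Circle.coe_one]
  · exact continuous_subtype_val.comp χ.continuous
  · refine chiMatchesAt'_seesaw_of_eq_torusWeight' q a g g' hgg' hg'g hgΩ lam hlam hiso (ha 1) (ha 3) hreal hcm eP' eM' _
      (fun κ hκ => ?_)
    have h1 := congrArg (fun c : Circle => (c : ℂ)) (hK ⟨κ, hκ⟩)
    simp only at h1
    show ((χ κ : Circle) : ℂ) = _
    rw [h1]
    exact hψ κ
  · -- `chi_centre`: the value on the centre is prescribed by `chi`
    have hzZ : (⟨z, centre_le_torusT' _ hz⟩ : torusT' _) ∈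
        (centre ((PlaneData.mixedRow q (a 0) (a 2)).withTransportedTorus g g' hgg' hg'g hgΩ)).subgroupOf
          (torusT' ((PlaneData.mixedRow q (a 0) (a 2)).withTransportedTorus g g' hgg' hg'g hgΩ)) :=
      Subgroup.mem_subgroupOf.2 hz
    have h2 := congrArg (fun c : Circle => (c : ℂ)) (hZ ⟨⟨z, centre_le_torusT' _ hz⟩, hzZ⟩)
    simp only at h2
    show chi ⟨z, centre_le_torusT _ hz⟩ = ((χ ⟨z, centre_le_torusT' _ hz⟩ : Circle) : ℂ)
    rw [h2, hω]

end Pair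

end Summit.Ventures.HodgeRepro.Tier4.Line4

end
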